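import Summits.Ventures.YMGap.RobustBall.PeriodisedFamilyS
import HarnessLib

/-!
# Venture YMGap, track ROBUST-BALL (Y2) — «C-ONE-W», step 2: THE VAN HOVE (PERIODISED TORUS) LIMIT STATES OF A TIER-2
# MEMBER ARE DLR STATES — summable, INFINITE-RANGE members; in the uniqueness regime they ARE the one state

HONEST FRAMING. WHAT THIS IS: a venture file (cell `pub-ymgap`, track Y2 ROBUST-BALL, seat ds-2), the tier-2 twin of
ds-3's `PeriodisedDLR.lean` / `OneState.lean`:
* ★ `mem_perturbedGibbsMeasuresS_of_mem_perturbedLimitPointsS` — for a link-summable potential `W` on `ℤ^d` with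
  continuous gauge-invariant terms reading their own links (ARBITRARY range), EVERY infinite-volume limit state of the
  perturbed torus states of the periodised family `periodisedFamilyS W …` (weak limits along torus sizes `L_k + 1 → ∞` on
  bounded continuous cylinder observables, rb-p2's `perturbedLimitPoints`) is a DLR state of the member's tier-2
  specification: `μ ∈ perturbedGibbsMeasuresS (fundamentalRep (Fin N)) β W`. PROOF: the cylinder DLR equations
  `μ(F) = μ(γ^W_Λ F)` (ds-3's `isGibbsMeasure_of_cylinderDLR`): on the `k`-th torus the state satisfies the `ℤ^d` DLR
  equation of the TRUNCATION at radius `L_k / 4` (ds-3's fixed-torus identity `expectation_boxMember_dlr`, applied to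
  the finite-range member `truncZd (L_k/4) 0 W`); the truncated kernels `γ^{trunc_m W}_Λ F` ARE bounded continuous
  cylinder observables and approximate `γ^W_Λ F` uniformly within `C τ_m(Λ) → 0`
  (`abs_integral_perturbedYMS_sub_truncZd_le`, `tendsto_farMajorant`); an `ε/3` passage.
* `exists_mem_perturbedLimitPointsS_mem_perturbedGibbsMeasuresS` — limit states exist (compactness, rb-p2) and are DLR;
  ★ `eq_of_mem_perturbedLimitPointsS_of_subsingleton` — in the uniqueness regime every torus limit state IS the one DLR
  state; ★★ `oneState_onBallZdW` — on every cell of the tier-2 mass-gap table `MassGapOnBallZdW d N β κ ε₀ ε₁` (first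
  clause: exactly one DLR state) the van Hove limit of EVERY member exists along the full sequence of tori in the
  sense that every limit point equals the member's one DLR state («C-ONE-W», the tier-2 twin of RBS row 1v).
WHAT THIS IS NOT: no rate of convergence; nothing about the continuum or the Clay problem.
References: H.-O. Georgii (2011) Thm. 4.17; the tree `PeriodisedDLR.lean`, `GibbsOfCylinderDLR.lean`, `OneState.lean` (ds-3),
`PerturbedLimitStates.lean` (rb-p2), `PeriodisedFamilyS.lean` (this seat), `MassGapOnBallS.lean` (rb-p1).
-/

noncomputable section

open MeasureTheory Filter Topology Function Finset
open Literature.Probability.LatticeModels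
open Literature.Probability.LatticeModels.DobrushinMetric (abs_integral_tilted_sub_integral_tilted_le_linear')
open Literature.MathematicalPhysics.QuantumLattice hiding torusNorm
open Literature.MathematicalPhysics.QuantumFieldTheory hiding ZdEdge Site
open Literature.MathematicalPhysics.QuantumFieldTheory.Balaban1983to89.StrongCouplingTorusWindow (specAvg)
open Summit.Ventures.YMGap.DSWindowZd

namespace Summit.Ventures.YMGap.RobustBall

variable {d N : ℕ}

/-! ### Infinite volume: limit states of the periodised family are DLR states of the summable member -/

section Limit

variable {W : Potential (ZdEdge d) (SUN N)} {Bm : Finset (ZdEdge d) → ℝ}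
  (hdep : ∀ X, DependsOn (W X) (↑X : Set (ZdEdge d))) (hg : ∀ X, IsZdGaugeInvariant (W X))
  (hWc : ∀ X, Continuous (W X))

/-- ★ **EVERY INFINITE-VOLUME LIMIT STATE OF THE PERIODISED TORUS STATES OF A SUMMABLE MEMBER IS A DLR STATE.** For a
link-summable potential `W` on `ℤ^d` with continuous gauge-invariant terms reading their own links (ARBITRARY range),
every `μ ∈ perturbedLimitPoints β (periodisedFamilyS W …)` — every weak limit along torus sizes `L_k + 1 → ∞` of the
perturbed torus states of the periodised family on bounded continuous cylinder observables — is a Gibbs measure of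
the member's tier-2 specification: `μ ∈ perturbedGibbsMeasuresS (fundamentalRep (Fin N)) β W`. [folklore] -/
theorem mem_perturbedGibbsMeasuresS_of_mem_perturbedLimitPointsS (h : IsLinkSummable W Bm) (β : ℝ)
    {μ : Measure (LGConfig d (SUN N))} (hμ : μ ∈ perturbedLimitPoints β (periodisedFamilyS W hdep hg hWc)) :
    μ ∈ perturbedGibbsMeasuresS (d := d) (fundamentalRep (Fin N)) β W := by
  classical
  haveI : SecondCountableTopology (Matrix (Fin N) (Fin N) ℂ) :=
    inferInstanceAs (SecondCountableTopology (Fin N → Fin N → ℂ))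
  haveI : SecondCountableTopology (SUN N) := Topology.IsEmbedding.subtypeVal.secondCountableTopology
  obtain ⟨Ls, hLs, hprob, hlim⟩ := hμ
  haveI := hprob
  have hρ : Continuous (fundamentalRep (Fin N)) := continuous_fundamentalRep (Fin N)
  have hspecZ : IsSpecification (perturbedYMS (d := d) (fundamentalRep (Fin N)) β W) :=
    isSpecification_perturbedYMS _ hρ β h hWc hdep
  refine isGibbsMeasure_of_cylinderDLR hspecZ
    (fun Λ F hF C hC => continuous_integral_perturbedYMS _ hρ β h hWc Λ hF hC) fun Λ F S₀ hFS hFc C hC => ?_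
  -- the truncated kernels: cylinder, continuous, bounded, close to the full kernel
  set τ : ℕ → ℝ := fun D => ∑' X : Finset (ZdEdge d),
    (if ¬ X ⊆ starNbhdZdR D 0 then ∑ e ∈ Λ, (if e ∈ X then Bm X else 0) else 0) with hτ
  set G : LGConfig d (SUN N) → ℝ := fun η => ∫ U, F U ∂(perturbedYMS (d := d) (fundamentalRep (Fin N)) β W Λ η)
    with hG
  set Gt : ℕ → LGConfig d (SUN N) → ℝ := fun D η =>
    ∫ U, F U ∂(perturbedYM (d := d) (fundamentalRep (Fin N)) β (truncZd D 0 W) (truncSuppZd D 0) Λ η) with hGt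
  have hC0 : 0 ≤ C := (abs_nonneg _).trans (hC fun _ => 1)
  have hGc : Continuous G := continuous_integral_perturbedYMS _ hρ β h hWc Λ hFc hC
  haveI hγprob : ∀ η, IsProbabilityMeasure (perturbedYMS (d := d) (fundamentalRep (Fin N)) β W Λ η) :=
    hspecZ.isProbability Λ
  haveI hγtprob : ∀ D η, IsProbabilityMeasure
      (perturbedYM (d := d) (fundamentalRep (Fin N)) β (truncZd D 0 W) (truncSuppZd D 0) Λ η) := fun D η =>
    isProbabilityMeasure_perturbedYM _ hρ β (measurable_truncZd hWc D 0) (exists_bound_truncZd hWc D 0) _ Λ η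
  have hbnd : ∀ {ν : Measure (LGConfig d (SUN N))} [IsProbabilityMeasure ν], |∫ U, F U ∂ν| ≤ C := fun {ν} _ => by
    have hh := norm_integral_le_of_norm_le_const (μ := ν) (f := F) (C := C)
      (ae_of_all _ fun U => by simpa [Real.norm_eq_abs] using hC U)
    simpa [Real.norm_eq_abs] using hh
  have hGb : ∀ η, |G η| ≤ C := fun η => hbnd
  have hGtb : ∀ D η, |Gt D η| ≤ C := fun D η => hbnd
  have hGtc : ∀ D, Continuous (Gt D) := fun D =>
    continuous_integral_perturbedYM _ hρ β (continuous_truncZd hWc D 0) (truncSuppZd D 0) Λ hFc hC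
  have hGtS : ∀ D, IsCylinder (Gt D) (S₀ ∪ (Λ ∪ Λ.biUnion (perturbedNbr (truncSuppZd D 0)))) := fun D =>
    dependsOn_specAvg_perturbedYM _ hρ β (measurable_truncZd hWc D 0) (dependsOn_truncZd hdep D 0)
      (isSupportedBy_truncZd D 0 W) Λ hFc.measurable hFS
  have happrox : ∀ D η, |G η - Gt D η| ≤ C * τ D := fun D η =>
    abs_integral_perturbedYMS_sub_truncZd_le h hWc β D Λ η hFc.measurable hC
  have hτ0 : Tendsto τ atTop (𝓝 0) := tendsto_farMajorant h Λ
  -- the torus expectations and their differences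
  set E : ℕ → (LGConfig d (SUN N) → ℝ) → ℝ := fun k H =>
    (periodisedFamilyS W hdep hg hWc (Ls k)).expectation (fundamentalRep (Fin N)) β (toTorusObservable (Ls k + 1) H)
    with hE
  have hEdiff : ∀ k {H₁ H₂ : LGConfig d (SUN N) → ℝ}, Continuous H₁ → Continuous H₂ → ∀ {δ : ℝ},
      (∀ η, |H₁ η - H₂ η| ≤ δ) → |E k H₁ - E k H₂| ≤ δ := by
    intro k H₁ H₂ h₁ h₂ δ hδ
    haveI := isProbabilityMeasure_perturbedTorusState β (Ls k + 1) (periodisedFamilyS W hdep hg hWc (Ls k))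
    simp only [hE, expectation_toTorusObservable _ _ _ h₁.measurable, expectation_toTorusObservable _ _ _ h₂.measurable]
    obtain ⟨B₁, hB₁⟩ := exists_bound_of_continuous h₁
    obtain ⟨B₂, hB₂⟩ := exists_bound_of_continuous h₂
    rw [← integral_sub (integrable_of_bound h₁.measurable.aestronglyMeasurable hB₁)
      (integrable_of_bound h₂.measurable.aestronglyMeasurable hB₂)]
    have hh := norm_integral_le_of_norm_le_const
      (μ := perturbedTorusState β (Ls k + 1) (periodisedFamilyS W hdep hg hWc (Ls k))) (f := fun η => H₁ η - H₂ η)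
      (C := δ) (ae_of_all _ fun η => by simpa [Real.norm_eq_abs] using hδ η)
    simpa [Real.norm_eq_abs] using hh
  -- (i) `E_k F → μ F`; (ii) for each `m`, `E_k (Gt m) → μ (Gt m)`
  have h1 : Tendsto (fun k => E k F) atTop (𝓝 (∫ U, F U ∂μ)) := hlim F S₀ hFS hFc ⟨C, hC⟩
  have h2 : ∀ m, Tendsto (fun k => E k (Gt m)) atTop (𝓝 (∫ η, Gt m η ∂μ)) := fun m =>
    hlim (Gt m) _ (hGtS m) (hGtc m) ⟨C, hGtb m⟩
  -- (iii) fixed torus: `E_k F = E_k (Gt (L_k / 4))` for all large `k`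
  have hk : Tendsto Ls atTop atTop := hLs.tendsto_atTop
  have hB := hk.eventually (eventually_subset_siteBox
    ((Λ ∪ (S₀ ∪ Λ) ∪ Λ.biUnion linkPlaqNbr ∪ (plaquettesTouching Λ).biUnion plaquetteEdges).image Prod.fst))
  have hev : ∀ᶠ k in atTop, E k F = E k (Gt (Ls k / 4)) := by
    filter_upwards [hB] with k hkB
    have hDn : Ls k / 4 ≤ Ls k / 2 := by omega
    have hact := activeFamily_truncZd_subset_boxFamily (W := W) hDn Λ
    have hbig : ((Λ ∪ (S₀ ∪ (Λ ∪ Λ.biUnion (perturbedNbr (truncSuppZd (Ls k / 4) 0)))) ∪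
        (plaquettesTouching Λ).biUnion plaquetteEdges).image Prod.fst) ⊆ siteBox d (Ls k / 2) := by
      have hΛ' : (Λ.biUnion linkPlaqNbr).image Prod.fst ⊆ siteBox d (Ls k / 2) := fun v hv => by
        refine hkB (Finset.mem_image.2 ?_)
        obtain ⟨y, hy, rfl⟩ := Finset.mem_image.1 hv
        exact ⟨y, Finset.mem_union_left _ (Finset.mem_union_right _ hy), rfl⟩
      have hN := perturbedNbr_truncSuppZd_base_subset hDn hΛ'
      intro v hv
      obtain ⟨y, hy, rfl⟩ := Finset.mem_image.1 hv
      rcases Finset.mem_union.1 hy with hy1 | hy2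
      · rcases Finset.mem_union.1 hy1 with hyΛ | hy3
        · exact hkB (Finset.mem_image_of_mem _ (Finset.mem_union_left _ (Finset.mem_union_left _
            (Finset.mem_union_left _ hyΛ))))
        · rcases Finset.mem_union.1 hy3 with hyS | hy4
          · exact hkB (Finset.mem_image_of_mem _ (Finset.mem_union_left _ (Finset.mem_union_left _
              (Finset.mem_union_right _ (Finset.mem_union_left _ hyS)))))
          · rcases Finset.mem_union.1 hy4 with hyΛ | hyN
            · exact hkB (Finset.mem_image_of_mem _ (Finset.mem_union_left _ (Finset.mem_union_left _
                (Finset.mem_union_left _ hyΛ))))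
            · exact hN (Finset.mem_image_of_mem _ hyN)
      · exact hkB (Finset.mem_image_of_mem _ (Finset.mem_union_right _ hy2))
    exact expectation_boxMember_dlr (dependsOn_truncZd hdep _ _) (isZdGaugeInvariant_truncZd hg _ _)
      (measurable_truncZd hWc _ _) (exists_bound_truncZd hWc _ _) (isSupportedBy_truncZd _ 0 W)
      (L := Ls k + 1) (n := Ls k / 2) (by omega) β Λ hFc hC hFS hact hbig
  -- (iv) for each `m`: `|μ F − μ (Gt m)| ≤ C τ_m`
  have hk4 : Tendsto (fun k => Ls k / 4) atTop atTop := by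
    refine tendsto_atTop_atTop.2 fun b => ?_
    obtain ⟨i, hi⟩ := tendsto_atTop_atTop.1 hk (4 * b)
    exact ⟨i, fun a ha => (Nat.le_div_iff_mul_le (by norm_num)).2 (by linarith [hi a ha])⟩
  have hDk : Tendsto (fun k => τ (Ls k / 4)) atTop (𝓝 0) := hτ0.comp hk4
  have hm_est : ∀ m, |∫ U, F U ∂μ - ∫ η, Gt m η ∂μ| ≤ C * τ m := by
    intro m
    have hl : Tendsto (fun k => |E k F - E k (Gt m)|) atTop (𝓝 |∫ U, F U ∂μ - ∫ η, Gt m η ∂μ|) :=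
      (h1.sub (h2 m)).abs
    have hr : Tendsto (fun k => C * (τ (Ls k / 4) + τ m)) atTop (𝓝 (C * (0 + τ m))) :=
      (hDk.add tendsto_const_nhds).const_mul C
    have hev2 : ∀ᶠ k in atTop, |E k F - E k (Gt m)| ≤ C * (τ (Ls k / 4) + τ m) := by
      filter_upwards [hev] with k hkk
      rw [hkk]
      refine hEdiff k (hGtc _) (hGtc m) fun η => ?_
      calc |Gt (Ls k / 4) η - Gt m η| ≤ |Gt (Ls k / 4) η - G η| + |G η - Gt m η| := abs_sub_le _ _ _
        _ ≤ C * τ (Ls k / 4) + C * τ m :=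
            add_le_add (by rw [abs_sub_comm]; exact happrox _ η) (happrox m η)
        _ = C * (τ (Ls k / 4) + τ m) := by ring
    have := le_of_tendsto_of_tendsto hl hr hev2
    simpa using this
  -- (v) `|μ (Gt m) − μ (γ_Λ F)| ≤ C τ_m`
  have hGdiff : ∀ m, |∫ η, Gt m η ∂μ - ∫ η, G η ∂μ| ≤ C * τ m := by
    intro m
    rw [← integral_sub (integrable_of_bound (hGtc m).measurable.aestronglyMeasurable (hGtb m))
      (integrable_of_bound hGc.measurable.aestronglyMeasurable hGb)]
    have hh := norm_integral_le_of_norm_le_const (μ := μ) (f := fun η => Gt m η - G η) (C := C * τ m)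
      (ae_of_all _ fun η => by rw [Real.norm_eq_abs, abs_sub_comm]; exact happrox m η)
    simpa [Real.norm_eq_abs] using hh
  -- (vi) conclude: `|μ F − μ (γ_Λ F)| ≤ 2 C τ_m → 0`
  have hall : ∀ m, |∫ U, F U ∂μ - ∫ η, G η ∂μ| ≤ 2 * C * τ m := fun m =>
    calc |∫ U, F U ∂μ - ∫ η, G η ∂μ|
        ≤ |∫ U, F U ∂μ - ∫ η, Gt m η ∂μ| + |∫ η, Gt m η ∂μ - ∫ η, G η ∂μ| := abs_sub_le _ _ _
      _ ≤ C * τ m + C * τ m := add_le_add (hm_est m) (hGdiff m)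
      _ = 2 * C * τ m := by ring
  have ht : Tendsto (fun m => 2 * C * τ m) atTop (𝓝 0) := by simpa using hτ0.const_mul (2 * C)
  have h0 : |∫ U, F U ∂μ - ∫ η, G η ∂μ| ≤ 0 := ge_of_tendsto' ht hall
  have := abs_nonpos_iff.1 h0
  linarith


/-- **The summable member has a DLR state which is a torus limit**: the periodised family has infinite-volume limit
states (rb-p2's `perturbedLimitPoints_nonempty`, compactness), and each is a DLR state of the member. [folklore] -/
theorem exists_mem_perturbedLimitPointsS_mem_perturbedGibbsMeasuresS (h : IsLinkSummable W Bm) (β : ℝ) :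
    ∃ μ ∈ perturbedLimitPoints β (periodisedFamilyS W hdep hg hWc),
      μ ∈ perturbedGibbsMeasuresS (d := d) (fundamentalRep (Fin N)) β W := by
  obtain ⟨μ, hμ⟩ := perturbedLimitPoints_nonempty β (periodisedFamilyS W hdep hg hWc)
  exact ⟨μ, hμ, mem_perturbedGibbsMeasuresS_of_mem_perturbedLimitPointsS hdep hg hWc h β hμ⟩

/-- ★ **UNIQUENESS REGIME: every torus limit state of the summable member IS the DLR state.** If the member's tier-2
specification has at most one Gibbs measure, then every infinite-volume limit state of the periodised family's torus
states equals every DLR state — ONE state. [folklore] -/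
theorem eq_of_mem_perturbedLimitPointsS_of_subsingleton (h : IsLinkSummable W Bm) (β : ℝ)
    (hsub : (perturbedGibbsMeasuresS (d := d) (fundamentalRep (Fin N)) β W).Subsingleton)
    {μ ν : Measure (LGConfig d (SUN N))} (hμ : μ ∈ perturbedLimitPoints β (periodisedFamilyS W hdep hg hWc))
    (hν : ν ∈ perturbedGibbsMeasuresS (d := d) (fundamentalRep (Fin N)) β W) : μ = ν :=
  hsub (mem_perturbedGibbsMeasuresS_of_mem_perturbedLimitPointsS hdep hg hWc h β hμ) hν

end Limit

/-! ### «C-ONE-W» on the tier-2 ball -/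

/-- ★★ **«C-ONE-W»: ON EVERY CELL OF THE TIER-2 MASS-GAP TABLE THE VAN HOVE LIMIT OF EVERY MEMBER IS ITS ONE DLR STATE.**
If `MassGapOnBallZdW d N β κ ε₀ ε₁` holds ('t Hooft coupling `β`, tree coupling `N β`; e.g. the `SU(2)` `ℤ⁴` cells up to
`β_W = 1/3` of `MassGapOnBallZdWRows*.lean`), then for EVERY member `W ∈ MemBallZdW κ ε₀ ε₁` — summable, gauge-invariant,
ARBITRARY range — every infinite-volume limit state of the perturbed torus states of its periodised family equals every
DLR state of `perturbedYMS (fundamentalRep (Fin N)) (N β) W`: the torus (van Hove) limit exists as a state and is THE one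
DLR state of the member. [folklore] -/
theorem oneState_onBallZdW {β κ ε₀ ε₁ : ℝ} (hgap : MassGapOnBallZdW d N β κ ε₀ ε₁)
    {W : Potential (ZdEdge d) (SUN N)} (hW : MemBallZdW κ ε₀ ε₁ W) {μ ν : Measure (LGConfig d (SUN N))}
    (hμ : μ ∈ perturbedLimitPoints ((N : ℝ) * β) (periodisedFamilyS W hW.dependsOn hW.gaugeInvariant hW.continuous))
    (hν : ν ∈ perturbedGibbsMeasuresS (d := d) (fundamentalRep (Fin N)) ((N : ℝ) * β) W) : μ = ν := by
  obtain ⟨Bm, hBm⟩ := hW.summable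
  exact eq_of_mem_perturbedLimitPointsS_of_subsingleton hW.dependsOn hW.gaugeInvariant hW.continuous hBm _
    (hgap W hW).1.1 hμ hν

/-- **On every cell of the tier-2 table, every member's periodised torus states HAVE a limit state and it is a DLR
state** (existence half of «C-ONE-W»). [folklore] -/
theorem exists_limitState_onBallZdW {κ ε₀ ε₁ : ℝ} (β : ℝ) {W : Potential (ZdEdge d) (SUN N)}
    (hW : MemBallZdW κ ε₀ ε₁ W) :
    ∃ μ ∈ perturbedLimitPoints β (periodisedFamilyS W hW.dependsOn hW.gaugeInvariant hW.continuous),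
      μ ∈ perturbedGibbsMeasuresS (d := d) (fundamentalRep (Fin N)) β W := by
  obtain ⟨Bm, hBm⟩ := hW.summable
  exact exists_mem_perturbedLimitPointsS_mem_perturbedGibbsMeasuresS hW.dependsOn hW.gaugeInvariant hW.continuous hBm β

end Summit.Ventures.YMGap.RobustBall

end
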